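import Mathlib
import HarnessLib

/-!
# `coker φ̄` over `T = S ⧸ (f)`: the two shared abbreviations of the W4.4b matrix-factorisation
# certificates (U7 stable-annihilator criterion, U10 lost assembly lemma)

Route `ResolutionOfSingularities/HomologicalConductor`, chain W4.4b (crux `Persistence`
stmt-ResolutionOfSingularities-16484), CHAIN v11.1 §H2L; the local abbreviations of res-L1-w44b-plan-1's
signature sketches `L/w44b/Sketch-U7.lean` / `Sketch-U10.lean`, landed ONCE so that U7 (res-D-pv-043) and
U10 (res-D-pv-026) state their theorems over literally the same objects. [OURS · L1 w44b; AI-written;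
NOT a statement of the manuscript under study.]

* `redLin f φ` — the square matrix `φ` over `S` reduced modulo `f`, as a `T`-linear endomorphism `φ̄` of
  `Tⁿ = Fin n → T`, `T = S ⧸ (f)`;
* `cokerMod f φ` — `M_φ := coker φ̄ = Tⁿ ⧸ range φ̄` as an object of `ModuleCat T`.

Universe-polymorphic in `S : Type u` (the sketches are the case `u = 0`). No theorems here.
-/

noncomputable section

-- single-problem summit: the doubled namespace component `ResolutionOfSingularities` is forced
set_option linter.dupNamespace false

namespace Summit.ResolutionOfSingularities.ResolutionOfSingularities.Theorems.HomologicalConductor.MFCoker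

universe u

variable {S : Type u} [CommRing S]

/-- `φ̄`: the matrix `φ` reduced modulo `f`, as a `T`-linear endomorphism of `Fin n → T`, `T = S ⧸ (f)`.
[OURS · L1 w44b · Sketch-U7/U10 `redLin`] -/
abbrev redLin (f : S) {n : ℕ} (φ : Matrix (Fin n) (Fin n) S) :
    (Fin n → S ⧸ Ideal.span ({f} : Set S)) →ₗ[S ⧸ Ideal.span ({f} : Set S)]
      (Fin n → S ⧸ Ideal.span ({f} : Set S)) :=
  (φ.map (Ideal.Quotient.mk (Ideal.span ({f} : Set S)))).mulVecLin

/-- `M_φ = coker φ̄ = Tⁿ ⧸ range φ̄` as an object of `ModuleCat T`, `T = S ⧸ (f)`.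
[OURS · L1 w44b · Sketch-U7/U10 `cokerMod`] -/
abbrev cokerMod (f : S) {n : ℕ} (φ : Matrix (Fin n) (Fin n) S) :
    ModuleCat.{u} (S ⧸ Ideal.span ({f} : Set S)) :=
  ModuleCat.of (S ⧸ Ideal.span ({f} : Set S))
    ((Fin n → S ⧸ Ideal.span ({f} : Set S)) ⧸ LinearMap.range (redLin f φ))

end Summit.ResolutionOfSingularities.ResolutionOfSingularities.Theorems.HomologicalConductor.MFCoker

end
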